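import Mathlib
import Literature.AlgebraicGeometry.Resolution.Lipman1969RationalContraction
import Literature.AlgebraicGeometry.Morphisms.CechH1Pullback
import Summits.ResolutionOfSingularities.ResolutionOfSingularities.Theorems.HomologicalConductorNoZenoSplittingBase
import HarnessLib

/-!
# Crux `NoZenoR` (stmt-ResolutionOfSingularities-19943), β layer, `stub_L1wCoreF` descent brick for BC-4b:
# FLAT BASE CHANGE OF GLOBAL SECTIONS and of Lipman's `h⁰`-LENGTHS

Route `ResolutionOfSingularities/HomologicalConductor`, crux chain W4.4.  OURS (cell res-hironaka, seat res-L0-w44-stub-2,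
(L1)-PREP v4 §2/§5, planner (ρ43e)/(ρ48): BC-4b over the Galois hop `S → Ŝ`); AI-written, weaker than expert review;
nothing here is a statement of the manuscript under review (Hironaka 2017).  Def-free, `--supports 19943 --as helper`.

For a cartesian square of schemes
```
      Y ──g──▶ X
   f_Y│        │f_X
      ▼        ▼
   Spec B ──▶ Spec A
```
with `A → B` FLAT and `X` quasi-compact quasi-separated, the global sections commute with the base change:
`Γ(Y, 𝒪_Y) ≅ B ⊗_A Γ(X, 𝒪_X)`, `B`-linearly (Mathlib's `isIso_pushoutSection_of_isQuasiSeparated_of_flat_right`, read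
through `CommRingCat.isPushout_iff_isPushout`; the model is the tree's `Morphisms/CechH1Localization`, which does the
affine-open / localisation case).  Consequently, for `A`, `B` LOCAL, `A → B` a flat local homomorphism with
`𝔪_A B = 𝔪_B` (any residue field extension), `length_B Γ(Y, 𝒪_Y) = length_A Γ(X, 𝒪_X)` (res-D-pv-039's BC-4′
`SplittingBase.length_baseChange_eq_of_map_maximalIdeal_eq`), and Lipman's `h⁰`-length of a closed subscheme is invariant:
**`h0 π_B (𝓘.comap σ) = h0 π 𝓘`** for the base change `σ : X_B → X` of an `S`-scheme `π : X → Spec S` with `X`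
Noetherian (the closed subscheme `V(𝓘.comap σ)` is `V(𝓘) ×_S Spec Ŝ`, Mathlib `IdealSheafData.comapIso`).

* `nonempty_linearEquiv_sections_top_of_flat` — `B ⊗_A Γ(X, 𝒪_X) ≃ₗ[B] Γ(Y, 𝒪_Y)`;
* `length_sections_top_eq_of_flat` — `length_B Γ(Y, 𝒪_Y) = length_A Γ(X, 𝒪_X)` (`𝔪_A B = 𝔪_B`);
* `isPullback_subscheme_comap` — the cartesian square `V(𝓘.comap σ) → V(𝓘)` over `Spec Ŝ → Spec S`;
* **`h0_comap_eq`** — `h0 π_B (𝓘.comap σ) = h0 π 𝓘`.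

This is the «numbers do not change upstairs» input of the proof of record of BC-4 (PREP v4 §2: `h⁰(𝓘_Ê) = h⁰(𝓘_E)`,
`h⁰(𝓘_Ê²) = h⁰(𝓘_E²)` along `S → Ŝ`).  References: The Stacks Project, Tag 02KH (flat base change of cohomology, degree
`0`); A. Grothendieck, J. Dieudonné, EGA III₁ Prop. (1.4.15); J. Lipman, Publ. Math. IHÉS 36 (1969) §10 p. 212 (`h⁰`)
[`Lipman1969`] (context).
-/

noncomputable section

-- single-problem summit: the doubled namespace component `ResolutionOfSingularities` is forced
set_option linter.dupNamespace false

namespace Summit.ResolutionOfSingularities.ResolutionOfSingularities.Theorems.NoZeno.ExcCount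

open CategoryTheory AlgebraicGeometry Limits TopologicalSpace Opposite IsLocalRing TensorProduct
open Literature.AlgebraicGeometry.Morphisms Literature.AlgebraicGeometry.Resolution

universe u

/-! ## §1 Flat base change of global sections -/

section Sections

variable {A B : Type u} [CommRing A] [CommRing B] [Algebra A B]
  {X Y : Scheme.{u}} (fX : X ⟶ Spec (.of A)) (fY' : Y ⟶ Spec (.of B)) (g : Y ⟶ X)
  (H : IsPullback g fY' fX (Spec.map (CommRingCat.ofHom (algebraMap A B))))

include H in
/-- **Flat base change of global sections** (`H⁰` of Stacks 02KH): for a cartesian square `Y = X ×_{Spec A} Spec B`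
with `A → B` flat and `X` quasi-compact and quasi-separated, `Γ(Y, 𝒪_Y) ≅ B ⊗_A Γ(X, 𝒪_X)`, linearly over `B`
(the `B`-structure of `Γ(Y, 𝒪_Y)` being the one through `f_Y : Y → Spec B`).
[cite: StacksProject, Tag 02KH (Cohomology of Schemes, Lemma 30.5.2), degree 0] -/
theorem nonempty_linearEquiv_sections_top_of_flat [Module.Flat A B] [CompactSpace X]
    [QuasiSeparatedSpace X] :
    Nonempty ((B ⊗[A] Sections fX ⊤) ≃ₗ[B] Sections fY' ⊤) := by
  have hg : g ≫ fX = fY' ≫ Spec.map (CommRingCat.ofHom (algebraMap A B)) := H.w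
  -- `Γ(Y, ⊤)` as an `A`-algebra through `f_Y ≫ (Spec B → Spec A)` (same type as `Sections fY' ⊤`)
  letI : Algebra B (Sections (fY' ≫ Spec.map (CommRingCat.ofHom (algebraMap A B))) ⊤) :=
    inferInstanceAs (Algebra B (Sections fY' ⊤))
  haveI : IsScalarTower A B (Sections (fY' ≫ Spec.map (CommRingCat.ofHom (algebraMap A B))) ⊤) := by
    refine IsScalarTower.of_algebraMap_eq fun a => ?_
    change Y.presheaf.map (homOfLE le_top).op
        (algebraMapΓ (fY' ≫ Spec.map (CommRingCat.ofHom (algebraMap A B))) a) =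
      Y.presheaf.map (homOfLE le_top).op (algebraMapΓ fY' (algebraMap A B a))
    congr 1
    change ((fY' ≫ Spec.map (CommRingCat.ofHom (algebraMap A B))).appTop.hom.comp
        (Scheme.ΓSpecIso (.of A)).inv.hom) a =
      (fY'.appTop.hom.comp (Scheme.ΓSpecIso (.of B)).inv.hom) (algebraMap A B a)
    have hnat := Scheme.ΓSpecIso_inv_naturality (CommRingCat.ofHom (algebraMap A B))
    rw [Scheme.Hom.comp_appTop]
    change (fY'.appTop.hom) (((Scheme.ΓSpecIso (.of A)).inv ≫
        (Spec.map (CommRingCat.ofHom (algebraMap A B))).appTop).hom a) =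
      fY'.appTop.hom ((Scheme.ΓSpecIso (.of B)).inv.hom (algebraMap A B a))
    rw [← hnat]
    rfl
  -- `Γ(Y, ⊤)` as a `Γ(X, ⊤)`-algebra through `g^*`, compatibly with the `A`-structures
  have htop : (⊤ : Y.Opens) ≤ g ⁻¹ᵁ ⊤ := le_top
  letI : Algebra (Sections fX ⊤) (Sections (fY' ≫ Spec.map (CommRingCat.ofHom (algebraMap A B))) ⊤) :=
    (g.appLE ⊤ ⊤ htop).hom.toAlgebra
  haveI : IsScalarTower A (Sections fX ⊤)
      (Sections (fY' ≫ Spec.map (CommRingCat.ofHom (algebraMap A B))) ⊤) :=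
    IsScalarTower.of_algebraMap_eq fun a =>
      ((Sections.comap fX _ g hg htop).commutes a).symm
  -- flatness of `Spec B → Spec A`
  haveI : Flat (Spec.map (CommRingCat.ofHom (algebraMap A B))) := by
    rw [HasRingHomProperty.Spec_iff (P := @Flat)]
    exact RingHom.flat_algebraMap_iff.mpr inferInstance
  -- Mathlib's flat base change of sections, with `U_S = ⊤`, `U_T = ⊤`, `U_X = ⊤`, `U_Y = ⊤`
  have hsq := (isIso_pushoutSection_iff H (US := ⊤) (UT := ⊤) (UX := ⊤) le_top le_top
      (UY := ⊤) (by simp)).mp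
    (isIso_pushoutSection_of_isQuasiSeparated_of_flat_right H le_top le_top (by simp)
      (isAffineOpen_top _) (isAffineOpen_top _) (by simpa using isCompact_univ)
      (by simpa using isQuasiSeparated_univ))
  -- replace the corners `Γ(Spec A, ⊤)`, `Γ(Spec B, ⊤)` by `A`, `B`
  have hsq' : IsPushout (CommRingCat.ofHom (algebraMap A (Sections fX ⊤)))
      (CommRingCat.ofHom (algebraMap A B))
      (CommRingCat.ofHom (algebraMap (Sections fX ⊤)
        (Sections (fY' ≫ Spec.map (CommRingCat.ofHom (algebraMap A B))) ⊤)))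
      (CommRingCat.ofHom (algebraMap B
        (Sections (fY' ≫ Spec.map (CommRingCat.ofHom (algebraMap A B))) ⊤))) := by
    refine IsPushout.of_iso hsq (Scheme.ΓSpecIso (.of A)) (Iso.refl _) (Scheme.ΓSpecIso (.of B))
      (Iso.refl _) ?_ ?_ ?_ ?_
    · simp only [Iso.refl_hom]
      rw [← Iso.inv_comp_eq]
      rfl
    · have happ : (Spec.map (CommRingCat.ofHom (algebraMap A B))).appLE ⊤ ⊤ le_top =
          (Spec.map (CommRingCat.ofHom (algebraMap A B))).appTop := rfl
      rw [happ]
      exact Scheme.ΓSpecIso_naturality _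
    · simp only [Iso.refl_hom]
      rfl
    · simp only [Iso.refl_hom]
      rw [← Iso.inv_comp_eq]
      rfl
  have hP : Algebra.IsPushout A B (Sections fX ⊤)
      (Sections (fY' ≫ Spec.map (CommRingCat.ofHom (algebraMap A B))) ⊤) :=
    CommRingCat.isPushout_iff_isPushout.mp hsq'.flip
  exact ⟨hP.out.equiv⟩

include H in
/-- **Lengths of global sections do not change under a flat local base change with `𝔪_A B = 𝔪_B`**: for `A`, `B` local,
`A → B` a flat local homomorphism with `𝔪_A·B = 𝔪_B` (the residue field may grow), and `Y = X ×_{Spec A} Spec B` with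
`X` quasi-compact quasi-separated, `length_B Γ(Y, 𝒪_Y) = length_A Γ(X, 𝒪_X)` (flat base change of sections, then
res-D-pv-039's `length_baseChange_eq_of_map_maximalIdeal_eq`). [cite: StacksProject, Tag 02KH (degree 0)] -/
theorem length_sections_top_eq_of_flat [IsLocalRing A] [IsLocalRing B] [IsLocalHom (algebraMap A B)]
    [Module.Flat A B] (hmax : (maximalIdeal A).map (algebraMap A B) = maximalIdeal B) [CompactSpace X]
    [QuasiSeparatedSpace X] :
    Module.length B (Sections fY' ⊤) = Module.length A (Sections fX ⊤) := by
  obtain ⟨e⟩ := nonempty_linearEquiv_sections_top_of_flat fX fY' g H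
  rw [← e.length_eq]
  exact SplittingBase.length_baseChange_eq_of_map_maximalIdeal_eq hmax (Sections fX ⊤)

end Sections

/-! ## §2 The closed subscheme of a pulled-back ideal sheaf is the base change of the closed subscheme -/

section Subscheme

variable {S Ŝ : Type u} [CommRing S] [CommRing Ŝ] [Algebra S Ŝ]
  {X XB : Scheme.{u}} (π : X ⟶ Spec (.of S)) (πB : XB ⟶ Spec (.of Ŝ)) (σ : XB ⟶ X)
  (H : IsPullback σ πB π (Spec.map (CommRingCat.ofHom (algebraMap S Ŝ))))
  (𝓘 : X.IdealSheafData)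

include H in
/-- **`V(𝓘.comap σ) = V(𝓘) ×_{Spec S} Spec Ŝ`**: for the base change `σ : X_B → X` of `π : X → Spec S` along
`Spec Ŝ → Spec S`, the closed subscheme of the pulled-back ideal sheaf sits in a cartesian square over `V(𝓘) → Spec S`
(Mathlib `IdealSheafData.comapIso`: `V(𝓘.comap σ) ≅ X_B ×_X V(𝓘)`, pasted with the given square). [folklore] -/
theorem isPullback_subscheme_comap :
    IsPullback ((𝓘.comapIso σ).hom ≫ pullback.snd σ 𝓘.subschemeι) ((𝓘.comap σ).subschemeι ≫ πB)
      (𝓘.subschemeι ≫ π) (Spec.map (CommRingCat.ofHom (algebraMap S Ŝ))) := by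
  -- `X_B ×_X V(𝓘) → V(𝓘)` over `X_B → X`, pasted with `X_B → Spec Ŝ` over `X → Spec S`
  have sq1 : IsPullback (pullback.snd σ 𝓘.subschemeι) (pullback.fst σ 𝓘.subschemeι) 𝓘.subschemeι σ :=
    (IsPullback.of_hasPullback σ 𝓘.subschemeι).flip
  have sq : IsPullback (pullback.snd σ 𝓘.subschemeι) (pullback.fst σ 𝓘.subschemeι ≫ πB)
      (𝓘.subschemeι ≫ π) (Spec.map (CommRingCat.ofHom (algebraMap S Ŝ))) :=
    sq1.paste_vert H
  refine IsPullback.of_iso sq (𝓘.comapIso σ).symm (Iso.refl _) (Iso.refl _) (Iso.refl _) ?_ ?_ ?_ ?_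
  · simp only [Iso.symm_hom, Iso.refl_hom, Category.comp_id, Iso.inv_hom_id_assoc]
  · simp only [Iso.symm_hom, Iso.refl_hom, Category.comp_id]
    rw [← Category.assoc, Scheme.IdealSheafData.comapIso_inv_subschemeι]
  · simp only [Iso.refl_hom, Category.comp_id, Category.id_comp]
  · simp only [Iso.refl_hom, Category.comp_id, Category.id_comp]

include H in
/-- **`h⁰` is invariant under flat local base change**: for `S`, `Ŝ` local, `S → Ŝ` a flat local homomorphism with
`𝔪_S·Ŝ = 𝔪_Ŝ`, `π : X → Spec S` with `X` Noetherian and `X_B = X ×_S Spec Ŝ` (`σ`, `π_B` the projections), and any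
ideal sheaf `𝓘` on `X`: `h0 π_B (𝓘.comap σ) = h0 π 𝓘` (Lipman's `h⁰(𝒪/𝓘)`, res-L1-type-o5's `h0`: the length over the
base of the global sections of the closed subscheme). [cite: StacksProject, Tag 02KH (degree 0)] -/
theorem h0_comap_eq [IsLocalRing S] [IsLocalRing Ŝ] [IsLocalHom (algebraMap S Ŝ)] [Module.Flat S Ŝ]
    (hmax : (maximalIdeal S).map (algebraMap S Ŝ) = maximalIdeal Ŝ) [IsNoetherian X] :
    h0 πB (𝓘.comap σ) = h0 π 𝓘 := by
  rw [h0_eq, h0_eq]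
  -- `V(𝓘)` is Noetherian (a closed subscheme of the Noetherian `X`), hence quasi-compact and quasi-separated
  haveI : CompactSpace (𝓘.subscheme : Scheme.{u}) :=
    QuasiCompact.compactSpace_of_compactSpace 𝓘.subschemeι
  haveI : QuasiSeparatedSpace (𝓘.subscheme : Scheme.{u}) :=
    quasiSeparatedSpace_of_quasiSeparated 𝓘.subschemeι
  exact length_sections_top_eq_of_flat (𝓘.subschemeι ≫ π) ((𝓘.comap σ).subschemeι ≫ πB)
    ((𝓘.comapIso σ).hom ≫ pullback.snd σ 𝓘.subschemeι) (isPullback_subscheme_comap π πB σ H 𝓘) hmax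

end Subscheme

end Summit.ResolutionOfSingularities.ResolutionOfSingularities.Theorems.NoZeno.ExcCount

end
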